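import Literature.Geometry.Lorentzian.VolumeChartIntegral
import Literature.Geometry.Riemannian.RiemannianDistance
import Literature.LinearAlgebra.Matrix.GramDeterminantTransform
import HarnessLib

/-!
# The Gram–Jacobian of a `C¹` map into a Riemannian manifold, in a chart

Let `M` be a manifold modelled on `ℝᵐ = EuclideanSpace ℝ (Fin m)` with a Riemannian metric `g`
(a `Literature.Geometry.Lorentzian.PseudoRiemannianMetric` on the tangent bundle with
`hg : g.IsRiemannian`), and let `F : ℝᵐ → M` be `C¹` at `u`. The **Gram–Jacobian** of `F` at `u`
is `𝒥_F(u) = √(det (g(DF eᵢ, DF eⱼ))ᵢⱼ)`, `DF = mfderiv F u`, `eᵢ` the standard basis. The main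
result `sqrt_det_gram_mfderiv_eq_chart` computes it in ANY extended chart
`φ = extChartAt (𝓡 m) q` whose domain contains `F u`:

  `𝒥_F(u) = |det D(φ ∘ F)(u)| · √(det h_{kl}(φ (F u)))`,

where `h_{kl} = chartGramMatrix (g.toContMDiffRiemannianMetric hg) q` is the Gram matrix of the
coordinate frame of `φ` (`Volume.lean`). Proof: the chain rule `DF = D(φ⁻¹) ∘ D(φ ∘ F)` (near
`u`, `F = φ⁻¹ ∘ (φ ∘ F)`), so that `(g(DF eᵢ, DF eⱼ)) = [D(φ ∘ F)]ᵀ (h_{kl}) [D(φ ∘ F)]`, and the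
transformation rule of Gram determinants
(`Literature.LinearAlgebra.Matrix.det_gram_comp_eq_det_sq_mul`). This is the pointwise identity
behind the area formula `Vol_g(F(S)) = ∫_S 𝒥_F` on a Riemannian manifold (Euclidean change of
variables + the chart formula `dV_g = √(det h_{kl}) dy` of the Riemannian measure).

## References

* H. Federer, *Geometric Measure Theory*, Springer 1969, §3.2.3 (area formula), §3.2.46.
* J. M. Lee, *Introduction to Riemannian Manifolds*, 2nd ed., Springer 2018, Prop. 2.41 ff.
  (`dV_g = √(det g_{ij}) dx` and its independence of the chart).
* I. Chavel, *Riemannian Geometry: A Modern Introduction*, 2nd ed., CUP 2006, §III.3.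
-/

noncomputable section

open Bundle Set Function Filter Manifold
open scoped Manifold ContDiff Topology

namespace Literature.Geometry.Riemannian

open Lorentzian Lorentzian.PseudoRiemannianMetric

variable {m : ℕ} {M : Type*} [TopologicalSpace M] [ChartedSpace (EuclideanSpace ℝ (Fin m)) M]
  [IsManifold (𝓡 m) ∞ M]
  (g : PseudoRiemannianMetric (𝓡 m) ∞ (EuclideanSpace ℝ (Fin m)) (TangentSpace (𝓡 m) : M → Type _))

/-- `√(det (B(L bᵢ, L bⱼ))) = |det L| · √(det (B(bᵢ, bⱼ)))` for a real bilinear form `B`, an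
endomorphism `L` and a basis `b` (square root of
`Literature.LinearAlgebra.Matrix.det_gram_comp_eq_det_sq_mul`; no sign condition is needed, both
sides vanish when `det (B(bᵢ, bⱼ)) < 0`). [folklore] -/
theorem sqrt_det_gram_bilin_comp {V : Type*} [AddCommGroup V] [Module ℝ V] {ι : Type*} [Fintype ι]
    [DecidableEq ι] (b : Module.Basis ι ℝ V) (B : LinearMap.BilinForm ℝ V) (L : V →ₗ[ℝ] V) :
    Real.sqrt (Matrix.of fun i j ↦ B (L (b i)) (L (b j))).det =
      |LinearMap.det L| * Real.sqrt (Matrix.of fun i j ↦ B (b i) (b j)).det := by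
  rw [Literature.LinearAlgebra.Matrix.det_gram_comp_eq_det_sq_mul, Real.sqrt_mul (sq_nonneg _),
    Real.sqrt_sq_eq_abs]

/-- **The Gram–Jacobian of a `C¹` map in a chart.** For a Riemannian `g` on a manifold `M`
modelled on `ℝᵐ`, a map `F : ℝᵐ → M` which is `C¹` at `u`, and any point `q` with `F u` in the
domain of the extended chart `φ = extChartAt (𝓡 m) q`,
`√(det (g(DF(u) eᵢ, DF(u) eⱼ))ᵢⱼ) = |det D(φ ∘ F)(u)| · √(det h_{kl}(φ (F u)))`, where
`DF(u) = mfderiv F u`, `eᵢ = EuclideanSpace.single i 1` and `h_{kl} = chartGramMatrix` is the Gram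
matrix of the coordinate frame `∂ₖ = D(φ⁻¹) eₖ` of the chart (chain rule `DF = D(φ⁻¹) ∘ D(φ ∘ F)`
and `det ([L]ᵀ G [L]) = (det L)² det G`). Lee 2018, Prop. 2.41 ff.; Federer 1969, §3.2.3.
[cite: LeeRiemannianManifolds2018, Prop. 2.41] -/
theorem sqrt_det_gram_mfderiv_eq_chart (hg : g.IsRiemannian)
    {F : EuclideanSpace ℝ (Fin m) → M} {u : EuclideanSpace ℝ (Fin m)}
    (hF : ContMDiffAt 𝓘(ℝ, EuclideanSpace ℝ (Fin m)) (𝓡 m) 1 F u) (q : M)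
    (hq : F u ∈ (extChartAt (𝓡 m) q).source) :
    Real.sqrt (Matrix.det (Matrix.of fun i j : Fin m ↦
      g.val (F u) (mfderiv 𝓘(ℝ, EuclideanSpace ℝ (Fin m)) (𝓡 m) F u (EuclideanSpace.single i (1 : ℝ)))
        (mfderiv 𝓘(ℝ, EuclideanSpace ℝ (Fin m)) (𝓡 m) F u (EuclideanSpace.single j (1 : ℝ))))) =
      |(fderiv ℝ ((extChartAt (𝓡 m) q) ∘ F) u).det| *
        Real.sqrt (Matrix.det (chartGramMatrix (g.toContMDiffRiemannianMetric hg) q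
          ((extChartAt (𝓡 m) q) (F u)))) := by
  set c := extChartAt (𝓡 m) q
  set ψ : EuclideanSpace ℝ (Fin m) → EuclideanSpace ℝ (Fin m) := c ∘ F
  -- differentiability of `F`, `φ`, `φ⁻¹` and `ψ = φ ∘ F`
  have hFd : MDifferentiableAt 𝓘(ℝ, EuclideanSpace ℝ (Fin m)) (𝓡 m) F u :=
    hF.mdifferentiableAt one_ne_zero
  have hq' : F u ∈ (chartAt (EuclideanSpace ℝ (Fin m)) q).source := by
    rwa [← extChartAt_source (𝓡 m)]
  have hcd : MDifferentiableAt (𝓡 m) 𝓘(ℝ, EuclideanSpace ℝ (Fin m)) c (F u) :=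
    mdifferentiableAt_extChartAt hq'
  have htgt : c (F u) ∈ c.target := c.map_source hq
  have hcsd : MDifferentiableAt 𝓘(ℝ, EuclideanSpace ℝ (Fin m)) (𝓡 m) c.symm (c (F u)) := by
    have := mdifferentiableWithinAt_extChartAt_symm htgt
    rwa [ModelWithCorners.range_eq_univ, mdifferentiableWithinAt_univ] at this
  have hψd : MDifferentiableAt 𝓘(ℝ, EuclideanSpace ℝ (Fin m)) 𝓘(ℝ, EuclideanSpace ℝ (Fin m)) ψ u :=
    hcd.comp u hFd
  have hψfd : mfderiv 𝓘(ℝ, EuclideanSpace ℝ (Fin m)) 𝓘(ℝ, EuclideanSpace ℝ (Fin m)) ψ u =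
      fderiv ℝ ψ u := mfderiv_eq_fderiv
  -- the chain rule `DF = D(φ⁻¹) ∘ Dψ`
  have heq : c.symm (c (F u)) = F u := c.left_inv hq
  have hev : F =ᶠ[𝓝 u] (c.symm ∘ ψ) := by
    have h1 : ∀ᶠ u' in 𝓝 u, F u' ∈ c.source :=
      hFd.continuousAt.preimage_mem_nhds ((isOpen_extChartAt_source (I := 𝓡 m) q).mem_nhds hq)
    filter_upwards [h1] with u' hu'
    exact (c.left_inv hu').symm
  set L₁ : EuclideanSpace ℝ (Fin m) →L[ℝ] EuclideanSpace ℝ (Fin m) :=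
    mfderiv 𝓘(ℝ, EuclideanSpace ℝ (Fin m)) (𝓡 m) c.symm (c (F u))
  set L₂ : EuclideanSpace ℝ (Fin m) →L[ℝ] EuclideanSpace ℝ (Fin m) := fderiv ℝ ψ u
  have hchain : ∀ v : EuclideanSpace ℝ (Fin m),
      mfderiv 𝓘(ℝ, EuclideanSpace ℝ (Fin m)) (𝓡 m) F u v = L₁ (L₂ v) := by
    have h := ((hcsd.hasMFDerivAt.comp u hψd.hasMFDerivAt).congr_of_eventuallyEq hev).mfderiv
    intro v
    rw [h, hψfd]
    rfl
  -- the metric at `F u`, as a bilinear form on `ℝᵐ`, composed with `L₁ = D(φ⁻¹)(φ (F u))`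
  set hin : EuclideanSpace ℝ (Fin m) →L[ℝ] EuclideanSpace ℝ (Fin m) →L[ℝ] ℝ := g.val (F u)
  set B : LinearMap.BilinForm ℝ (EuclideanSpace ℝ (Fin m)) :=
    LinearMap.BilinForm.comp hin.toLinearMap₁₂
      (L₁ : EuclideanSpace ℝ (Fin m) →ₗ[ℝ] EuclideanSpace ℝ (Fin m))
      (L₁ : EuclideanSpace ℝ (Fin m) →ₗ[ℝ] EuclideanSpace ℝ (Fin m))
  have hB_apply : ∀ v w, B v w = g.val (F u) (L₁ v) (L₁ w) := fun v w ↦ rfl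
  set b := (EuclideanSpace.basisFun (Fin m) ℝ).toBasis with hb
  have hb_apply : ∀ i, b i = EuclideanSpace.single i 1 := fun i ↦ by
    rw [hb, OrthonormalBasis.coe_toBasis, EuclideanSpace.basisFun_apply]
  -- the Gram matrix of `F`
  have hgram : (Matrix.of fun i j : Fin m ↦
      g.val (F u) (mfderiv 𝓘(ℝ, EuclideanSpace ℝ (Fin m)) (𝓡 m) F u (EuclideanSpace.single i (1 : ℝ)))
        (mfderiv 𝓘(ℝ, EuclideanSpace ℝ (Fin m)) (𝓡 m) F u (EuclideanSpace.single j (1 : ℝ)))) =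
      Matrix.of fun i j ↦ B ((L₂ : EuclideanSpace ℝ (Fin m) →ₗ[ℝ] EuclideanSpace ℝ (Fin m)) (b i))
        ((L₂ : EuclideanSpace ℝ (Fin m) →ₗ[ℝ] EuclideanSpace ℝ (Fin m)) (b j)) := by
    ext i j
    rw [Matrix.of_apply, Matrix.of_apply, hB_apply, ContinuousLinearMap.coe_coe, hb_apply,
      hb_apply, hchain, hchain]
  -- the Gram matrix of the chart
  have hchart : chartGramMatrix (g.toContMDiffRiemannianMetric hg) q (c (F u)) =
      Matrix.of fun i j ↦ B (b i) (b j) := by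
    ext i j
    rw [Matrix.of_apply, hB_apply, hb_apply, hb_apply, chartGramMatrix, Matrix.of_apply]
    simp only [ModelWithCorners.range_eq_univ, mfderivWithin_univ]
    rw [heq]
    rfl
  rw [hgram, hchart,
    sqrt_det_gram_bilin_comp b B (L₂ : EuclideanSpace ℝ (Fin m) →ₗ[ℝ] EuclideanSpace ℝ (Fin m))]

end Literature.Geometry.Riemannian

end
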